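import Mathlib.RingTheory.Norm.Transitivity
import Mathlib.RingTheory.Complex
import Mathlib.LinearAlgebra.Orientation
import Mathlib.LinearAlgebra.FiniteDimensional.Lemmas
import Mathlib.Analysis.Normed.Module.FiniteDimension
import Mathlib.Topology.Instances.Matrix
import Mathlib.Tactic.Module
import HarnessLib

/-!
# Complex structures on real vector spaces: complex-linear maps have positive real
# determinant, and the complex orientation in real dimension `4`

Topic `Literature/Geometry/Symplectic` (linear algebra underlying the complex orientation of an
almost complex / Stein `4`-manifold, `SteinOrientation.lean`).  For a real vector space `V` with
a complex structure `J` (`J² = -1`, `ComplexStructure V`):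

* `ComplexStructure.Carrier` — `V` as a complex vector space, `(a + bi) • v = a v + b J v`, with
  `IsScalarTower ℝ ℂ`; `complexify` — a real-linear map commuting with `J` is complex-linear;
* `ComplexStructure.det_pos_of_commute` — **a real-linear automorphism commuting with `J` has
  positive determinant**: `det_ℝ A = N_{ℂ/ℝ}(det_ℂ A) = |det_ℂ A|²` (Mathlib's
  `LinearMap.det_restrictScalars` and `Algebra.norm_complex_apply`), and `det_ℝ A ≠ 0`;
* in real dimension `4`: adapted bases `(v, Jv, w, Jw)` (`IsAdaptedBasis`, they exist:
  `exists_isAdaptedBasis`), any two of which define the same orientation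
  (`orientation_eq_of_isAdaptedBasis`: the change of basis commutes with `J`), whence **the
  complex orientation** `ComplexStructure.orientation`; it is natural under linear
  isomorphisms (`map_orientation`: `T_* o(J) = o(T J T⁻¹)`) and **locally constant in `J`**
  (`eventually_orientation_eq`: for `J'` near `J`, `(b₀, J' b₀, b₂, J' b₂)` is still a basis,
  with determinant close to `1` in the adapted basis `b` of `J`).

Everything is proved; no facts.

## References

* M. W. Hirsch, *Differential Topology*, GTM 33 (1976), §4.4 (orientations). [HirschDT1976]
* K. Cieliebak, Ya. Eliashberg, *From Stein to Weinstein and back*, AMS Coll. Publ. 59 (2012),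
  Ch. 2 (complex structures, the complex orientation). [CieliebakEliashberg2012]
-/

noncomputable section

open Set Function Module Filter
open scoped Topology

namespace Literature.Geometry.Symplectic

/-! ### Complex structures and the complex scalar action -/

/-- **A complex structure on a real vector space**: an endomorphism `J` with `J² = -1`.
[folklore] -/
structure ComplexStructure (V : Type*) [AddCommGroup V] [Module ℝ V] where
  /-- the endomorphism -/
  J : V →ₗ[ℝ] V
  /-- `J² = -1` -/
  J_sq : ∀ v, J (J v) = -v

namespace ComplexStructure

variable {V : Type*} [AddCommGroup V] [Module ℝ V]

/-- Two complex structures with the same `J` are equal. [folklore] -/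
theorem ext' {c c' : ComplexStructure V} (h : c.J = c'.J) : c = c' := by
  cases c; cases c'; cases h; rfl

/-- **The complex vector space defined by a complex structure**: the same additive group, with
`(a + bi) • v = a v + b J v` (a type synonym carrying the `ℂ`-module instance). [folklore] -/
def Carrier (_c : ComplexStructure V) : Type _ := V

/-- The additive group of the complex vector space is that of `V`. [folklore] -/
instance instAddCommGroupCarrier (c : ComplexStructure V) : AddCommGroup c.Carrier :=
  inferInstanceAs (AddCommGroup V)

/-- The real vector space structure of the complex vector space is that of `V`. [folklore] -/
instance instModuleRealCarrier (c : ComplexStructure V) : Module ℝ c.Carrier :=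
  inferInstanceAs (Module ℝ V)

/-- The identity `V ≃ c.Carrier` (real-linear). [folklore] -/
def toCarrier (c : ComplexStructure V) : V ≃ₗ[ℝ] c.Carrier := LinearEquiv.refl ℝ V

/-- The complex scalar action `(a + bi) • v = a v + b J v`. [folklore] -/
instance instSMulComplexCarrier (c : ComplexStructure V) : SMul ℂ c.Carrier :=
  ⟨fun z v => c.toCarrier (z.re • c.toCarrier.symm v + z.im • c.J (c.toCarrier.symm v))⟩

/-- Unfolding the complex scalar action. [folklore] -/
theorem smul_def (c : ComplexStructure V) (z : ℂ) (v : c.Carrier) :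
    z • v = c.toCarrier (z.re • c.toCarrier.symm v + z.im • c.J (c.toCarrier.symm v)) := rfl

/-- `toCarrier⁻¹ ∘ toCarrier = id`. [folklore] -/
@[simp] theorem toCarrier_symm_apply_toCarrier (c : ComplexStructure V) (v : V) :
    c.toCarrier.symm (c.toCarrier v) = v := rfl

/-- `toCarrier ∘ toCarrier⁻¹ = id`. [folklore] -/
@[simp] theorem toCarrier_apply_toCarrier_symm (c : ComplexStructure V) (v : c.Carrier) :
    c.toCarrier (c.toCarrier.symm v) = v := rfl

/-- The complex action read in `V`. [folklore] -/
theorem toCarrier_symm_smul (c : ComplexStructure V) (z : ℂ) (v : c.Carrier) :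
    c.toCarrier.symm (z • v) = z.re • c.toCarrier.symm v + z.im • c.J (c.toCarrier.symm v) := rfl

/-- The complex scalar action is a `ℂ`-module structure (`J² = -1` gives `i² = -1`).
[folklore] -/
instance instModuleComplexCarrier (c : ComplexStructure V) : Module ℂ c.Carrier where
  one_smul v := by
    apply c.toCarrier.symm.injective
    simp [toCarrier_symm_smul]
  mul_smul z w v := by
    apply c.toCarrier.symm.injective
    simp only [toCarrier_symm_smul, Complex.mul_re, Complex.mul_im, map_add, map_smul, c.J_sq]
    module
  smul_zero z := by
    apply c.toCarrier.symm.injective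
    simp [toCarrier_symm_smul]
  smul_add z u v := by
    apply c.toCarrier.symm.injective
    simp only [toCarrier_symm_smul, map_add]
    module
  add_smul z w v := by
    apply c.toCarrier.symm.injective
    simp only [toCarrier_symm_smul, Complex.add_re, Complex.add_im, map_add]
    module
  zero_smul v := by
    apply c.toCarrier.symm.injective
    simp [toCarrier_symm_smul]

/-- The real and complex actions are compatible. [folklore] -/
instance instIsScalarTowerCarrier (c : ComplexStructure V) : IsScalarTower ℝ ℂ c.Carrier :=
  ⟨fun r z v => by
    apply c.toCarrier.symm.injective
    rw [LinearEquiv.map_smul]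
    simp only [toCarrier_symm_smul, Complex.real_smul, Complex.mul_re, Complex.ofReal_re,
      Complex.ofReal_im, Complex.mul_im, zero_mul, sub_zero, add_zero]
    module⟩

/-- **A real-linear map commuting with `J` is complex-linear.** [folklore] -/
def complexify (c : ComplexStructure V) (A : V →ₗ[ℝ] V) (hA : ∀ v, A (c.J v) = c.J (A v)) :
    c.Carrier →ₗ[ℂ] c.Carrier where
  toFun v := c.toCarrier (A (c.toCarrier.symm v))
  map_add' u v := by rw [map_add, map_add, map_add]
  map_smul' z v := by
    apply c.toCarrier.symm.injective
    simp only [RingHom.id_apply, toCarrier_symm_smul, toCarrier_symm_apply_toCarrier, map_add,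
      map_smul, hA]

/-- Restricting the scalars of the complexification gives back the real-linear map.
[folklore] -/
theorem complexify_restrictScalars (c : ComplexStructure V) (A : V →ₗ[ℝ] V)
    (hA : ∀ v, A (c.J v) = c.J (A v)) :
    ((c.complexify A hA).restrictScalars ℝ : V →ₗ[ℝ] V) = A :=
  LinearMap.ext fun _ => rfl

/-- **A real-linear automorphism commuting with a complex structure has positive determinant**:
`det_ℝ A = N_{ℂ/ℝ}(det_ℂ A) = |det_ℂ A|² > 0` (`LinearMap.det_restrictScalars`,
`Algebra.norm_complex_apply`). [folklore] -/
theorem det_pos_of_commute [FiniteDimensional ℝ V] (c : ComplexStructure V) (A : V ≃ₗ[ℝ] V)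
    (hA : ∀ v, A (c.J v) = c.J (A v)) : 0 < LinearMap.det (A : V →ₗ[ℝ] V) := by
  have h := LinearMap.det_restrictScalars (R := ℝ) (S := ℂ) (A := c.Carrier)
    (f := c.complexify (A : V →ₗ[ℝ] V) hA)
  rw [c.complexify_restrictScalars, Algebra.norm_complex_apply] at h
  have h2 : LinearMap.det (A : V →ₗ[ℝ] V) =
      Complex.normSq (LinearMap.det (c.complexify (A : V →ₗ[ℝ] V) hA)) := h
  have hne : LinearMap.det (A : V →ₗ[ℝ] V) ≠ 0 := by
    rw [← LinearEquiv.coe_det]; exact (LinearEquiv.det A).ne_zero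
  rw [h2] at hne ⊢
  exact lt_of_le_of_ne (Complex.normSq_nonneg _) (Ne.symm hne)

/-- Conjugating a complex structure by a linear isomorphism. [folklore] -/
def conj {V' : Type*} [AddCommGroup V'] [Module ℝ V'] (c : ComplexStructure V) (T : V ≃ₗ[ℝ] V') :
    ComplexStructure V' where
  J := (T : V →ₗ[ℝ] V') ∘ₗ c.J ∘ₗ (T.symm : V' →ₗ[ℝ] V)
  J_sq v := by simp [c.J_sq]

/-- Unfolding `conj`. [folklore] -/
@[simp] theorem conj_J_apply {V' : Type*} [AddCommGroup V'] [Module ℝ V'] (c : ComplexStructure V)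
    (T : V ≃ₗ[ℝ] V') (v : V') : (c.conj T).J v = T (c.J (T.symm v)) := rfl

/-! ### Adapted bases in real dimension `4` and the complex orientation -/

/-- **A `J`-adapted basis** of a `4`-dimensional real vector space: `(v, Jv, w, Jw)`.
[folklore] -/
def IsAdaptedBasis (J : V →ₗ[ℝ] V) (b : Basis (Fin 4) ℝ V) : Prop :=
  b 1 = J (b 0) ∧ b 3 = J (b 2)

/-- `J` in an adapted basis: `J b₀ = b₁`, `J b₁ = -b₀`, `J b₂ = b₃`, `J b₃ = -b₂`. [folklore] -/
theorem IsAdaptedBasis.apply_eq (c : ComplexStructure V) {b : Basis (Fin 4) ℝ V}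
    (hb : IsAdaptedBasis c.J b) :
    c.J (b 0) = b 1 ∧ c.J (b 1) = -b 0 ∧ c.J (b 2) = b 3 ∧ c.J (b 3) = -b 2 := by
  refine ⟨hb.1.symm, ?_, hb.2.symm, ?_⟩
  · rw [hb.1, c.J_sq]
  · rw [hb.2, c.J_sq]

/-- **Two adapted bases of a complex structure define the same orientation**: the change of
basis commutes with `J`, so it has positive determinant (`det_pos_of_commute`). [folklore] -/
theorem orientation_eq_of_isAdaptedBasis [FiniteDimensional ℝ V] (c : ComplexStructure V)
    {b b' : Basis (Fin 4) ℝ V} (hb : IsAdaptedBasis c.J b) (hb' : IsAdaptedBasis c.J b') :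
    b.orientation = b'.orientation := by
  rw [Basis.orientation_eq_iff_det_pos]
  set f : V ≃ₗ[ℝ] V := b.equiv b' (Equiv.refl _) with hf
  have hfb : ∀ i, f (b i) = b' i := fun i => by simp [hf]
  obtain ⟨h0, h1, h2, h3⟩ := hb.apply_eq c
  obtain ⟨h0', h1', h2', h3'⟩ := hb'.apply_eq c
  have hcomm : ∀ v, f (c.J v) = c.J (f v) := by
    have key : (f : V →ₗ[ℝ] V) ∘ₗ c.J = c.J ∘ₗ (f : V →ₗ[ℝ] V) := by
      refine b.ext fun i => ?_
      simp only [LinearMap.coe_comp, LinearEquiv.coe_coe, Function.comp_apply]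
      fin_cases i
      · show f (c.J (b 0)) = c.J (f (b 0)); rw [h0, hfb, hfb, h0']
      · show f (c.J (b 1)) = c.J (f (b 1)); rw [h1, map_neg, hfb, hfb, h1']
      · show f (c.J (b 2)) = c.J (f (b 2)); rw [h2, hfb, hfb, h2']
      · show f (c.J (b 3)) = c.J (f (b 3)); rw [h3, map_neg, hfb, hfb, h3']
    intro v
    exact LinearMap.congr_fun key v
  have hdet : b.det b' = LinearMap.det (f : V →ₗ[ℝ] V) := by
    have h1 : (b' : Fin 4 → V) = (f : V →ₗ[ℝ] V) ∘ b := funext fun i => (hfb i).symm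
    rw [h1, Basis.det_comp, Basis.det_self, mul_one]
  rw [hdet]
  exact c.det_pos_of_commute f hcomm

/-- `J` has no real eigenvector: `v, Jv` are linearly independent for `v ≠ 0`. [folklore] -/
theorem linearIndependent_pair (c : ComplexStructure V) {v : V} (hv : v ≠ 0) :
    LinearIndependent ℝ ![v, c.J v] := by
  rw [LinearIndependent.pair_iff]
  intro s t hst
  have h2 : s • c.J v - t • v = 0 := by
    have := congrArg c.J hst
    rw [map_add, map_smul, map_smul, c.J_sq, map_zero, smul_neg, ← sub_eq_add_neg] at this
    exact this
  have h3 : (s * s + t * t) • v = 0 := by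
    have : s • (s • v + t • c.J v) - t • (s • c.J v - t • v) = (s * s + t * t) • v := by module
    rw [← this, hst, h2, smul_zero, smul_zero, sub_zero]
  rw [smul_eq_zero] at h3
  rcases h3 with h3 | h3
  · constructor <;> nlinarith [mul_self_nonneg s, mul_self_nonneg t]
  · exact absurd h3 hv

/-- If `w ∉ span{v, Jv}` then `Jw ∉ span{v, Jv, w}` (the span of `v, Jv` is `J`-invariant).
[folklore] -/
theorem J_not_mem_span (c : ComplexStructure V) {v w : V}
    (hw : w ∉ Submodule.span ℝ (Set.range ![v, c.J v])) :
    c.J w ∉ Submodule.span ℝ (Set.range ![v, c.J v, w]) := by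
  intro hmem
  rw [Submodule.mem_span_range_iff_exists_fun] at hmem
  obtain ⟨k, hk⟩ := hmem
  simp only [Fin.sum_univ_three, Matrix.cons_val_zero, Matrix.cons_val_one,
    Matrix.cons_val] at hk
  -- apply `J`: `-w = k₀ Jv - k₁ v + k₂ Jw`
  have hk2 := congrArg c.J hk
  simp only [map_add, map_smul, c.J_sq] at hk2
  rw [← hk] at hk2
  -- so `(1 + k₂²) w ∈ span{v, Jv}`
  apply hw
  have hX : (k 0 • c.J v + k 1 • -v + k 2 • (k 0 • v + k 1 • c.J v + k 2 • w)) + w = 0 := by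
    rw [hk2]; abel
  have hspan : (1 + k 2 * k 2) • w = (k 1 - k 2 * k 0) • v + (-(k 0) - k 2 * k 1) • c.J v := by
    have e : (1 + k 2 * k 2) • w - ((k 1 - k 2 * k 0) • v + (-(k 0) - k 2 * k 1) • c.J v) =
        (k 0 • c.J v + k 1 • -v + k 2 • (k 0 • v + k 1 • c.J v + k 2 • w)) + w := by module
    rw [hX] at e
    exact sub_eq_zero.1 e
  have hne : (1 + k 2 * k 2) ≠ 0 := by nlinarith [mul_self_nonneg (k 2)]
  have hw' : w = (1 + k 2 * k 2)⁻¹ • ((k 1 - k 2 * k 0) • v + (-(k 0) - k 2 * k 1) • c.J v) := by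
    rw [← hspan, smul_smul, inv_mul_cancel₀ hne, one_smul]
  rw [hw']
  refine Submodule.smul_mem _ _ (Submodule.add_mem _ (Submodule.smul_mem _ _ ?_)
    (Submodule.smul_mem _ _ ?_))
  · exact Submodule.subset_span ⟨0, rfl⟩
  · exact Submodule.subset_span ⟨1, rfl⟩

/-- **Every complex structure on a `4`-dimensional real vector space admits an adapted basis**
`(v, Jv, w, Jw)`: `v ≠ 0`, `w ∉ span{v, Jv}`. [folklore] -/
theorem exists_isAdaptedBasis [FiniteDimensional ℝ V] (c : ComplexStructure V)
    (h4 : finrank ℝ V = 4) : ∃ b : Basis (Fin 4) ℝ V, IsAdaptedBasis c.J b := by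
  -- a nonzero vector
  have hnt : Nontrivial V := Module.nontrivial_of_finrank_pos (R := ℝ) (by omega)
  obtain ⟨v, hv⟩ := exists_ne (0 : V)
  have hli2 := c.linearIndependent_pair hv
  -- a vector outside `span{v, Jv}`
  have hlt : Submodule.span ℝ (Set.range ![v, c.J v]) < ⊤ := by
    refine Submodule.lt_top_of_finrank_lt_finrank (lt_of_le_of_lt (finrank_range_le_card _) ?_)
    rw [h4]; simp
  obtain ⟨w, -, hw⟩ := SetLike.exists_of_lt hlt
  -- the family `(v, Jv, w, Jw)` is linearly independent
  have hli3 : LinearIndependent ℝ ![v, c.J v, w] := by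
    have e1 : Fin.init ![v, c.J v, w] = ![v, c.J v] := by
      funext i; fin_cases i <;> rfl
    have e2 : ![v, c.J v, w] (Fin.last 2) = w := rfl
    rw [linearIndependent_finSucc', e1, e2]
    exact ⟨hli2, hw⟩
  have hli4 : LinearIndependent ℝ ![v, c.J v, w, c.J w] := by
    have e1 : Fin.init ![v, c.J v, w, c.J w] = ![v, c.J v, w] := by
      funext i; fin_cases i <;> rfl
    have e2 : ![v, c.J v, w, c.J w] (Fin.last 3) = c.J w := rfl
    rw [linearIndependent_finSucc', e1, e2]
    exact ⟨hli3, c.J_not_mem_span hw⟩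
  refine ⟨basisOfLinearIndependentOfCardEqFinrank hli4 (by simp [h4]), ?_, ?_⟩ <;>
    simp [coe_basisOfLinearIndependentOfCardEqFinrank]

/-- **The complex orientation** of a complex structure on a `4`-dimensional real vector space:
the orientation of any adapted basis `(v, Jv, w, Jw)` (well defined by
`orientation_eq_of_isAdaptedBasis`). [folklore] -/
def orientation [FiniteDimensional ℝ V] (c : ComplexStructure V) (h4 : finrank ℝ V = 4) :
    _root_.Orientation ℝ V (Fin 4) :=
  (c.exists_isAdaptedBasis h4).choose.orientation

/-- The complex orientation is the orientation of every adapted basis. [folklore] -/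
theorem orientation_eq_of_isAdapted [FiniteDimensional ℝ V] (c : ComplexStructure V)
    (h4 : finrank ℝ V = 4) {b : Basis (Fin 4) ℝ V} (hb : IsAdaptedBasis c.J b) :
    c.orientation h4 = b.orientation :=
  c.orientation_eq_of_isAdaptedBasis (c.exists_isAdaptedBasis h4).choose_spec hb

/-- An adapted basis is transported by a linear isomorphism `T` to an adapted basis of the
conjugate complex structure `T J T⁻¹`. [folklore] -/
theorem isAdaptedBasis_map {V' : Type*} [AddCommGroup V'] [Module ℝ V'] (c : ComplexStructure V)
    {b : Basis (Fin 4) ℝ V} (hb : IsAdaptedBasis c.J b) (T : V ≃ₗ[ℝ] V') :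
    IsAdaptedBasis (c.conj T).J (b.map T) := by
  constructor
  · simp [hb.1]
  · simp [hb.2]

/-- **The complex orientation is natural**: transporting it along `T` gives the complex
orientation of `T J T⁻¹`. [folklore] -/
theorem map_orientation {V' : Type*} [AddCommGroup V'] [Module ℝ V'] [FiniteDimensional ℝ V]
    [FiniteDimensional ℝ V'] (c : ComplexStructure V) (h4 : finrank ℝ V = 4)
    (h4' : finrank ℝ V' = 4) (T : V ≃ₗ[ℝ] V') :
    Orientation.map (Fin 4) T (c.orientation h4) = (c.conj T).orientation h4' := by
  obtain ⟨b, hb⟩ := c.exists_isAdaptedBasis h4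
  rw [c.orientation_eq_of_isAdapted h4 hb, ← Basis.orientation_map,
    (c.conj T).orientation_eq_of_isAdapted h4' (c.isAdaptedBasis_map hb T)]

/-! ### Local constancy of the complex orientation in `J` -/

section Topology

variable {E : Type*} [NormedAddCommGroup E] [NormedSpace ℝ E] [FiniteDimensional ℝ E]

/-- The determinant `b.det (v₀, …, v₃)` depends continuously on the vectors. [folklore] -/
theorem continuous_basis_det (b : Basis (Fin 4) ℝ E) :
    Continuous fun v : Fin 4 → E => b.det v := by
  have h : (fun v : Fin 4 → E => b.det v) = fun v => (b.toMatrix v).det := by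
    funext v; exact b.det_apply v
  rw [h]
  refine Continuous.matrix_det ?_
  refine continuous_pi fun i => continuous_pi fun j => ?_
  show Continuous fun v : Fin 4 → E => b.repr (v j) i
  have h1 : Continuous fun x : E => b.repr x i := (b.coord i).continuous_of_finiteDimensional
  exact h1.comp (continuous_apply j)

/-- **The complex orientation is locally constant in `J`.**  If `b` is adapted to `J₀`, then for
`J` near `J₀` the family `(b₀, J b₀, b₂, J b₂)` is still a basis with the same orientation as
`b` (its determinant in `b` is close to `1`), so every complex structure `J` near `J₀` has the
same complex orientation as `J₀`. [folklore] -/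
theorem eventually_orientation_eq (h4 : finrank ℝ E = 4) (c₀ : ComplexStructure E)
    (J₀ : E →L[ℝ] E) (hJ₀ : (J₀ : E →ₗ[ℝ] E) = c₀.J) :
    ∀ᶠ J : E →L[ℝ] E in 𝓝 J₀, ∀ hJ : ∀ v, (J : E →ₗ[ℝ] E) ((J : E →ₗ[ℝ] E) v) = -v,
      (⟨(J : E →ₗ[ℝ] E), hJ⟩ : ComplexStructure E).orientation h4 = c₀.orientation h4 := by
  obtain ⟨b, hb⟩ := c₀.exists_isAdaptedBasis h4
  -- the family `(b₀, J b₀, b₂, J b₂)` and its determinant in `b`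
  set fam : (E →L[ℝ] E) → Fin 4 → E := fun J => ![b 0, J (b 0), b 2, J (b 2)] with hfam
  have hfam0 : fam J₀ = b := by
    funext i
    have h0 : J₀ (b 0) = b 1 := by
      rw [hb.1, ← hJ₀]; rfl
    have h2 : J₀ (b 2) = b 3 := by
      rw [hb.2, ← hJ₀]; rfl
    fin_cases i
    · rfl
    · exact h0
    · rfl
    · exact h2
  have hcont : Continuous fun J : E →L[ℝ] E => b.det (fam J) := by
    refine (continuous_basis_det b).comp ?_
    refine continuous_pi fun i => ?_
    fin_cases i
    · exact continuous_const
    · exact (ContinuousLinearMap.apply ℝ E (b 0)).continuous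
    · exact continuous_const
    · exact (ContinuousLinearMap.apply ℝ E (b 2)).continuous
  have h1 : b.det (fam J₀) = 1 := by rw [hfam0, Basis.det_self]
  have hpos : ∀ᶠ J : E →L[ℝ] E in 𝓝 J₀, 0 < b.det (fam J) :=
    hcont.continuousAt.eventually_mem (Ioi_mem_nhds (by rw [h1]; exact one_pos))
  filter_upwards [hpos] with J hJpos hJ
  -- `fam J` is a basis adapted to `J`, with the orientation of `b`
  have hbasis := (Module.Basis.is_basis_iff_det b).2 (isUnit_iff_ne_zero.2 hJpos.ne')
  set b' : Basis (Fin 4) ℝ E := Basis.mk hbasis.1 hbasis.2.ge with hb'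
  have hb'c : ⇑b' = fam J := Basis.coe_mk _ _
  have hadapt : IsAdaptedBasis (J : E →ₗ[ℝ] E) b' := by
    constructor
    · rw [hb'c]; rfl
    · rw [hb'c]; rfl
  rw [ComplexStructure.orientation_eq_of_isAdapted ⟨(J : E →ₗ[ℝ] E), hJ⟩ h4 hadapt,
    c₀.orientation_eq_of_isAdapted h4 hb, eq_comm, Basis.orientation_eq_iff_det_pos]
  rwa [hb'c]

end Topology

end ComplexStructure

end Literature.Geometry.Symplectic

end
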